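import Literature.AlgebraicGeometry.Frobenioids.Composites
import HarnessLib

/-!
# Frobenioids I, Proposition 1.10 (Morphisms of Frobenius Type), parts (i), (ii)

Mochizuki, *The geometry of Frobenioids I: the general theory*, Kyushu J. Math. **62** (2008)
293–400, §1, Proposition 1.10 (i), (ii) and their proof, kurims text pp. 34–35
[cite: MochizukiFrdI2008, Prop. 1.10]. Standing data: `C → F_Φ` a Frobenioid (`hF`).

> "(i) Let `φ : A → B` be an arbitrary morphism of `C`. Suppose that `α : A → A'`, `β : B → B'`
> are morphisms of Frobenius type, of Frobenius degree `d ∈ N_{≥1}`. Then there exists a unique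
> morphism `φ' : A' → B'` such that [`φ' ∘ α = β ∘ φ`]. In this situation,
> `deg_Fr(φ) = deg_Fr(φ')`; `Div(φ') = d · α_*(Div(φ))` [where we write `α_* : Φ(A) ⥲ Φ(A')`
> for the bijection induced by applying the functor `Φ` to the base-isomorphism `α`]. Finally,
> if `φ` is a morphism of Frobenius type (respectively, pre-step; pull-back morphism; co-angular
> morphism; base-isomorphism; isometry; LB-invertible morphism), then the same is true of `φ'`.
> (ii) Any composite morphism `β ∘ α` of `C`, where `α` is a pre-step, and `β` is of Frobenius
> type, may be written as a composite `α' ∘ β' = β ∘ α` where `α'` is a pre-step, and `β'` is of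
> Frobenius type such that: `deg_Fr(β) = deg_Fr(β')`; `Div(α') = deg_Fr(β) · β'_*(Div(α))`."

Everything is PROVED along the printed proof (p. 35): uniqueness by total epimorphicity;
existence first for `φ` of Frobenius type (Def. 1.3 (ii)), then for pre-steps (Def. 1.3 (iv)(a),
Prop. 1.4 (iv)), then for pull-back morphisms (Prop. 1.4 (v)), then in general via the
factorisation of Def. 1.3 (iv)(a); the `deg_Fr`/`Div` formulae by Remark 1.1.1; (ii) from (i).

Renderings (recorded for the referee). Composition is diagrammatic (`α ≫ φ' = φ ≫ β`). Monoids
are multiplicative, so `d · x` is `x ^ d`; `α_*` is `pull Φ (inv (Base α))`, the inverse of the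
pull-back bijection `α^* = pull Φ (Base α)`. No statement of the paper is strengthened.
-/

namespace Literature.AlgebraicGeometry.Frobenioids

open CategoryTheory Opposite

universe w v v' u u'

namespace PreFrobenioid

variable {D : Type u} [Category.{v} D] {Φ : Dᵒᵖ ⥤ CommMonCat.{w}}
  {C : Type u'} [Category.{v'} C] {F : C ⥤ ElemFrobenioid Φ}

/-! ### Proposition 1.10 (i): uniqueness and the three special cases -/

/-- **Prop. 1.10 (i)**, uniqueness: "uniqueness follows from the fact that `C` is totally
epimorphic". [cite: MochizukiFrdI2008, Prop. 1.10(i) p.35] -/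
theorem frobeniusConjugate_unique (hP : IsPreFrobenioid Φ F) {A B A' B' : C} {φ : A ⟶ B}
    {α : A ⟶ A'} {β : B ⟶ B'} {φ' φ'' : A' ⟶ B'} (h' : α ≫ φ' = φ ≫ β) (h'' : α ≫ φ'' = φ ≫ β) :
    φ' = φ'' := by
  haveI := hP.isTotallyEpimorphic.epi α
  exact (cancel_epi α).mp (h'.trans h''.symm)

/-- **Prop. 1.10 (i)**, existence for `φ` of Frobenius type: "since morphisms of Frobenius type
are closed under composition, with multiplying Frobenius degrees, the existence … follows … from
the existence and (essential) uniqueness of morphisms of Frobenius type of a given Frobenius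
degree [Def. 1.3 (ii)]". [cite: MochizukiFrdI2008, Prop. 1.10(i) p.35] -/
theorem exists_frobeniusConjugate_of_isFrobeniusType (hF : IsFrobenioid F) {A B A' B' : C}
    {φ : A ⟶ B} (hφ : IsFrobeniusType F φ) {α : A ⟶ A'} {β : B ⟶ B'} (hα : IsFrobeniusType F α)
    (hβ : IsFrobeniusType F β) (hd : degFr F α = degFr F β) :
    ∃ φ' : A' ⟶ B', IsFrobeniusType F φ' ∧ α ≫ φ' = φ ≫ β := by
  have hP := hF.isPreFrobenioid
  obtain ⟨Z, μ, hμ, hμd⟩ := hF.ii_exists A' (degFr F φ)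
  have h1 : IsFrobeniusType F (α ≫ μ) := IsFrobeniusType.comp F hF hα hμ
  have h2 : IsFrobeniusType F (φ ≫ β) := IsFrobeniusType.comp F hF hφ hβ
  obtain ⟨i, hi⟩ := hF.ii_unique (α ≫ μ) (φ ≫ β) h1 h2
    (by rw [degFr_comp, degFr_comp, hμd, hd, mul_comm])
  exact ⟨μ ≫ i.hom, IsFrobeniusType.comp F hF hμ (isFrobeniusType_of_isIso F hP i.hom),
    by rw [← Category.assoc, hi]⟩

/-- **Prop. 1.10 (i)**, existence for `φ` a pre-step, "[which, moreover, is co-angular if `φ`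
is]": via the factorisation of Def. 1.3 (iv)(a) of `β ∘ φ` [cf. Prop. 1.4 (iv)] and the
essential uniqueness of morphisms of Frobenius type of a given degree.
[cite: MochizukiFrdI2008, Prop. 1.10(i) p.35] -/
theorem exists_frobeniusConjugate_of_isPreStep (hF : IsFrobenioid F) {A B A' B' : C}
    {φ : A ⟶ B} (hφ : IsPreStep F φ) {α : A ⟶ A'} {β : B ⟶ B'} (hα : IsFrobeniusType F α)
    (hβ : IsFrobeniusType F β) (hd : degFr F α = degFr F β) :
    ∃ φ' : A' ⟶ B', IsPreStep F φ' ∧ (IsCoAngular F φ → IsCoAngular F φ') ∧ α ≫ φ' = φ ≫ β := by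
  have hP := hF.isPreFrobenioid
  have hD := hP.isTotallyEpimorphic_base
  have hC := hP.isTotallyEpimorphic
  obtain ⟨X, Y, γ, β₀, α₀, hfac, hγ, hβ₀, hα₀⟩ := hF.iv_a_exists (φ ≫ β)
  -- `φ ≫ β` is a base-isomorphism, so the pull-back part `α₀` is an isomorphism
  have hbi : IsBaseIso F (φ ≫ β) := IsBaseIso.comp F hφ.2 hβ.2
  have hα₀b : IsBaseIso F α₀ := by
    have h : IsBaseIso F (γ ≫ β₀ ≫ α₀) := by rw [hfac]; exact hbi
    exact (isBaseIso_factors F hD (isBaseIso_factors F hD h).1).1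
  haveI : IsIso α₀ := (isPullbackMorphism_and_isBaseIso_iff_isIso F α₀).mp ⟨hα₀, hα₀b⟩
  -- degrees: `deg γ = deg β = deg α`
  have hγd : degFr F γ = degFr F α := by
    have h := congrArg (degFr F) hfac
    rw [degFr_comp, degFr_comp, degFr_comp, show degFr F β₀ = 1 from hβ₀.1,
      isLinear_of_isIso F α₀, mul_one, mul_one, show degFr F φ = 1 from hφ.1, one_mul] at h
    rw [h, hd]
  obtain ⟨i, hi⟩ := hF.ii_unique γ α hγ hα hγd
  refine ⟨i.inv ≫ β₀ ≫ α₀, IsPreStep.comp F (isPreStep_of_isIso F i.inv)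
    (IsPreStep.comp F hβ₀ (isPreStep_of_isIso F α₀)), fun hco => ?_, ?_⟩
  · have hβ₀co : IsCoAngular F β₀ :=
      (isCoAngular_iff_of_factorization F hF (φ ≫ β) γ β₀ α₀ hfac hγ hβ₀ hα₀).mp
        (IsCoAngular.comp F hF hco hβ.1.1)
    exact IsCoAngular.comp F hF (isCoAngular_of_isIso F hC i.inv)
      (IsCoAngular.comp F hF hβ₀co (isCoAngular_of_isIso F hC α₀))
  · rw [← hi, Category.assoc, i.hom_inv_id_assoc, hfac]

/-- **Prop. 1.10 (i)**, existence for `φ` a pull-back morphism: "since pull-back morphisms are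
LB-invertible [Prop. 1.4 (ii)], and LB-invertible morphisms are closed under composition
[Prop. 1.7 (i)], the existence of a pull-back morphism `φ'` … follows … from the factorization of
Proposition 1.4, (v)". [cite: MochizukiFrdI2008, Prop. 1.10(i) p.35] -/
theorem exists_frobeniusConjugate_of_isPullbackMorphism (hF : IsFrobenioid F) {A B A' B' : C}
    {φ : A ⟶ B} (hφ : IsPullbackMorphism F φ) {α : A ⟶ A'} {β : B ⟶ B'}
    (hα : IsFrobeniusType F α) (hβ : IsFrobeniusType F β) (hd : degFr F α = degFr F β) :
    ∃ φ' : A' ⟶ B', IsPullbackMorphism F φ' ∧ α ≫ φ' = φ ≫ β := by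
  have hP := hF.isPreFrobenioid
  obtain ⟨hφlb, hφlin⟩ := hF.iv_b φ hφ
  have hlb : IsLBInvertible F (φ ≫ β) := IsLBInvertible.comp F hF hφlb hβ.1
  obtain ⟨X, γ, α₀, hfac, hγ, hα₀⟩ := (isLBInvertible_iff_exists_factorization F hF (φ ≫ β)).mp hlb
  have hγd : degFr F γ = degFr F α := by
    have h := congrArg (degFr F) hfac
    rw [degFr_comp, degFr_comp, (hF.iv_b α₀ hα₀).2, mul_one, show degFr F φ = 1 from hφlin,
      one_mul] at h
    rw [h, hd]
  obtain ⟨i, hi⟩ := hF.ii_unique γ α hγ hα hγd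
  refine ⟨i.inv ≫ α₀, IsPullbackMorphism.comp F (isPullbackMorphism_of_isIso F i.inv) hα₀, ?_⟩
  rw [← hi, Category.assoc, i.hom_inv_id_assoc, hfac]

/-! ### Proposition 1.10 (i): the general case -/

/-- **Prop. 1.10 (i)**, existence in general [cf. the factorization of Def. 1.3 (iv)(a)], together
with: "if `φ` is co-angular then so is `φ'`" (Prop. 1.4 (iv) and Def. 1.3 (iii)(a)).
[cite: MochizukiFrdI2008, Prop. 1.10(i) p.35] -/
theorem exists_frobeniusConjugate (hF : IsFrobenioid F) {A B A' B' : C} (φ : A ⟶ B)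
    {α : A ⟶ A'} {β : B ⟶ B'} (hα : IsFrobeniusType F α) (hβ : IsFrobeniusType F β)
    (hd : degFr F α = degFr F β) :
    ∃ φ' : A' ⟶ B', (IsCoAngular F φ → IsCoAngular F φ') ∧ α ≫ φ' = φ ≫ β := by
  have hP := hF.isPreFrobenioid
  obtain ⟨X, Y, γ, β₀, α₀, hfac, hγ, hβ₀, hα₀⟩ := hF.iv_a_exists φ
  obtain ⟨X', μ₁, hμ₁, hμ₁d⟩ := hF.ii_exists X (degFr F α)
  obtain ⟨Y', μ₂, hμ₂, hμ₂d⟩ := hF.ii_exists Y (degFr F α)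
  obtain ⟨φ₁, hφ₁, h₁⟩ := exists_frobeniusConjugate_of_isFrobeniusType hF hγ hα hμ₁ hμ₁d.symm
  obtain ⟨φ₂, -, hφ₂co, h₂⟩ := exists_frobeniusConjugate_of_isPreStep hF hβ₀ hμ₁ hμ₂
    (hμ₁d.trans hμ₂d.symm)
  obtain ⟨φ₃, hφ₃, h₃⟩ := exists_frobeniusConjugate_of_isPullbackMorphism hF hα₀ hμ₂ hβ
    (hμ₂d.trans hd)
  refine ⟨φ₁ ≫ φ₂ ≫ φ₃, fun hco => ?_, ?_⟩
  · have hβ₀co : IsCoAngular F β₀ :=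
      (isCoAngular_iff_of_factorization F hF φ γ β₀ α₀ hfac hγ hβ₀ hα₀).mp hco
    exact IsCoAngular.comp F hF hφ₁.1.1
      (IsCoAngular.comp F hF (hφ₂co hβ₀co) (hF.iv_b φ₃ hφ₃).1.1)
  · rw [reassoc_of% h₁, reassoc_of% h₂, h₃, ← hfac, Category.assoc, Category.assoc]

/-- **Prop. 1.10 (i)**: existence and uniqueness of `φ'` with `φ' ∘ α = β ∘ φ`.
[cite: MochizukiFrdI2008, Prop. 1.10(i) p.34] -/
theorem existsUnique_frobeniusConjugate (hF : IsFrobenioid F) {A B A' B' : C} (φ : A ⟶ B)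
    {α : A ⟶ A'} {β : B ⟶ B'} (hα : IsFrobeniusType F α) (hβ : IsFrobeniusType F β)
    (hd : degFr F α = degFr F β) : ∃! φ' : A' ⟶ B', α ≫ φ' = φ ≫ β := by
  obtain ⟨φ', -, h⟩ := exists_frobeniusConjugate hF φ hα hβ hd
  exact ⟨φ', h, fun φ'' h'' => frobeniusConjugate_unique hF.isPreFrobenioid h'' h⟩

/-! ### Proposition 1.10 (i): `deg_Fr` and `Div` of `φ'` -/

/-- **Prop. 1.10 (i)**: "`deg_Fr(φ) = deg_Fr(φ')`" (Remark 1.1.1).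
[cite: MochizukiFrdI2008, Prop. 1.10(i) p.34] -/
theorem degFr_frobeniusConjugate {A B A' B' : C} {φ : A ⟶ B} {α : A ⟶ A'} {β : B ⟶ B'}
    {φ' : A' ⟶ B'} (h : α ≫ φ' = φ ≫ β) (hd : degFr F α = degFr F β) :
    degFr F φ' = degFr F φ := by
  have h' := congrArg (degFr F) h
  rw [degFr_comp, degFr_comp, hd, mul_comm (degFr F φ)] at h'
  exact mul_left_cancel h'

/-- **Prop. 1.10 (i)**: "`Div(φ') = d · α_*(Div(φ))`", multiplicatively
`Div(φ') = (α_* Div φ)^d` with `α_* = ((Base α)^*)⁻¹` (Remark 1.1.1; `α`, `β` are isometries).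
[cite: MochizukiFrdI2008, Prop. 1.10(i) p.34] -/
theorem div_frobeniusConjugate {A B A' B' : C} {φ : A ⟶ B} {α : A ⟶ A'} {β : B ⟶ B'}
    {φ' : A' ⟶ B'} (h : α ≫ φ' = φ ≫ β) (hα : IsFrobeniusType F α) (hβ : IsFrobeniusType F β) :
    haveI : IsIso (Base F α) := hα.2
    Div F φ' = (pull Φ (inv (Base F α)) (Div F φ)) ^ (degFr F β : ℕ) := by
  haveI : IsIso (Base F α) := hα.2
  have h' := congrArg (Div F) h
  rw [div_comp, div_comp, show Div F α = 1 from hα.1.2, one_pow, mul_one,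
    show Div F β = 1 from hβ.1.2, map_one, one_mul] at h'
  have := congrArg (pull Φ (inv (Base F α))) h'
  rwa [← pull_comp, IsIso.inv_hom_id, pull_id, map_pow] at this

/-! ### Proposition 1.10 (i): transfer of properties to `φ'` -/

/-- **Prop. 1.10 (i)**: if `φ` is of Frobenius type then so is `φ'`.
[cite: MochizukiFrdI2008, Prop. 1.10(i) p.34] -/
theorem IsFrobeniusType.frobeniusConjugate (hF : IsFrobenioid F) {A B A' B' : C} {φ : A ⟶ B}
    (hφ : IsFrobeniusType F φ) {α : A ⟶ A'} {β : B ⟶ B'} {φ' : A' ⟶ B'} (h : α ≫ φ' = φ ≫ β)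
    (hα : IsFrobeniusType F α) (hβ : IsFrobeniusType F β) (hd : degFr F α = degFr F β) :
    IsFrobeniusType F φ' := by
  obtain ⟨φ'', hφ'', h''⟩ := exists_frobeniusConjugate_of_isFrobeniusType hF hφ hα hβ hd
  rwa [frobeniusConjugate_unique hF.isPreFrobenioid h h'']

/-- **Prop. 1.10 (i)**: if `φ` is a pre-step then so is `φ'`. [cite: MochizukiFrdI2008, Prop. 1.10(i) p.34] -/
theorem IsPreStep.frobeniusConjugate (hF : IsFrobenioid F) {A B A' B' : C} {φ : A ⟶ B}
    (hφ : IsPreStep F φ) {α : A ⟶ A'} {β : B ⟶ B'} {φ' : A' ⟶ B'} (h : α ≫ φ' = φ ≫ β)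
    (hα : IsFrobeniusType F α) (hβ : IsFrobeniusType F β) (hd : degFr F α = degFr F β) :
    IsPreStep F φ' := by
  obtain ⟨φ'', hφ'', -, h''⟩ := exists_frobeniusConjugate_of_isPreStep hF hφ hα hβ hd
  rwa [frobeniusConjugate_unique hF.isPreFrobenioid h h'']

/-- **Prop. 1.10 (i)**: if `φ` is a pull-back morphism then so is `φ'`.
[cite: MochizukiFrdI2008, Prop. 1.10(i) p.34] -/
theorem IsPullbackMorphism.frobeniusConjugate (hF : IsFrobenioid F) {A B A' B' : C} {φ : A ⟶ B}
    (hφ : IsPullbackMorphism F φ) {α : A ⟶ A'} {β : B ⟶ B'} {φ' : A' ⟶ B'} (h : α ≫ φ' = φ ≫ β)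
    (hα : IsFrobeniusType F α) (hβ : IsFrobeniusType F β) (hd : degFr F α = degFr F β) :
    IsPullbackMorphism F φ' := by
  obtain ⟨φ'', hφ'', h''⟩ := exists_frobeniusConjugate_of_isPullbackMorphism hF hφ hα hβ hd
  rwa [frobeniusConjugate_unique hF.isPreFrobenioid h h'']

/-- **Prop. 1.10 (i)**: if `φ` is co-angular then so is `φ'`. [cite: MochizukiFrdI2008, Prop. 1.10(i) p.34] -/
theorem IsCoAngular.frobeniusConjugate (hF : IsFrobenioid F) {A B A' B' : C} {φ : A ⟶ B}
    (hφ : IsCoAngular F φ) {α : A ⟶ A'} {β : B ⟶ B'} {φ' : A' ⟶ B'} (h : α ≫ φ' = φ ≫ β)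
    (hα : IsFrobeniusType F α) (hβ : IsFrobeniusType F β) (hd : degFr F α = degFr F β) :
    IsCoAngular F φ' := by
  obtain ⟨φ'', hφ'', h''⟩ := exists_frobeniusConjugate hF φ hα hβ hd
  rw [frobeniusConjugate_unique hF.isPreFrobenioid h h'']
  exact hφ'' hφ

/-- **Prop. 1.10 (i)**: if `φ` is a base-isomorphism then so is `φ'` (`Base α`, `Base β` are
isomorphisms). [cite: MochizukiFrdI2008, Prop. 1.10(i) p.34] -/
theorem IsBaseIso.frobeniusConjugate (hP : IsPreFrobenioid Φ F) {A B A' B' : C} {φ : A ⟶ B}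
    (hφ : IsBaseIso F φ) {α : A ⟶ A'} {β : B ⟶ B'} {φ' : A' ⟶ B'} (h : α ≫ φ' = φ ≫ β)
    (hα : IsFrobeniusType F α) (hβ : IsFrobeniusType F β) : IsBaseIso F φ' := by
  have h' : IsBaseIso F (α ≫ φ') := by rw [h]; exact IsBaseIso.comp F hφ hβ.2
  have := hα
  exact (isBaseIso_factors F hP.isTotallyEpimorphic_base h').1

/-- **Prop. 1.10 (i)**: if `φ` is an isometry then so is `φ'` (by the `Div` formula).
[cite: MochizukiFrdI2008, Prop. 1.10(i) p.34] -/
theorem IsIsometry.frobeniusConjugate {A B A' B' : C} {φ : A ⟶ B} (hφ : IsIsometry F φ)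
    {α : A ⟶ A'} {β : B ⟶ B'} {φ' : A' ⟶ B'} (h : α ≫ φ' = φ ≫ β) (hα : IsFrobeniusType F α)
    (hβ : IsFrobeniusType F β) : IsIsometry F φ' := by
  show Div F φ' = 1
  rw [div_frobeniusConjugate h hα hβ, show Div F φ = 1 from hφ, map_one, one_pow]

/-- **Prop. 1.10 (i)**: if `φ` is LB-invertible then so is `φ'`. [cite: MochizukiFrdI2008, Prop. 1.10(i) p.34] -/
theorem IsLBInvertible.frobeniusConjugate (hF : IsFrobenioid F) {A B A' B' : C} {φ : A ⟶ B}
    (hφ : IsLBInvertible F φ) {α : A ⟶ A'} {β : B ⟶ B'} {φ' : A' ⟶ B'} (h : α ≫ φ' = φ ≫ β)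
    (hα : IsFrobeniusType F α) (hβ : IsFrobeniusType F β) (hd : degFr F α = degFr F β) :
    IsLBInvertible F φ' :=
  ⟨hφ.1.frobeniusConjugate hF h hα hβ hd, hφ.2.frobeniusConjugate h hα hβ⟩

/-! ### Proposition 1.10 (ii) -/

/-- **Prop. 1.10 (ii)**: a composite `β ∘ α` (`α ≫ β`) with `α` a pre-step and `β` of Frobenius
type can be rewritten as `α' ∘ β'` (`β' ≫ α'`) with `β'` of Frobenius type of the same degree
and `α'` a pre-step with `Div(α') = deg_Fr(β) · β'_*(Div α)` ("follows formally from assertion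
(i)" and the existence of morphisms of Frobenius type of a given degree, Def. 1.3 (ii)).
[cite: MochizukiFrdI2008, Prop. 1.10(ii) p.34] -/
theorem exists_frobeniusType_preStep_swap (hF : IsFrobenioid F) {A B B' : C} (α : A ⟶ B)
    (hα : IsPreStep F α) (β : B ⟶ B') (hβ : IsFrobeniusType F β) :
    ∃ (A' : C) (β' : A ⟶ A') (α' : A' ⟶ B') (hβ' : IsFrobeniusType F β'), IsPreStep F α' ∧
      β' ≫ α' = α ≫ β ∧ degFr F β' = degFr F β ∧
        haveI : IsIso (Base F β') := hβ'.2
        Div F α' = (pull Φ (inv (Base F β')) (Div F α)) ^ (degFr F β : ℕ) := by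
  obtain ⟨A', β', hβ', hβ'd⟩ := hF.ii_exists A (degFr F β)
  obtain ⟨α', hα', -, h⟩ := exists_frobeniusConjugate_of_isPreStep hF hα hβ' hβ hβ'd
  exact ⟨A', β', α', hβ', hα', h, hβ'd, div_frobeniusConjugate h hβ' hβ⟩

end PreFrobenioid

end Literature.AlgebraicGeometry.Frobenioids
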